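import Summits.HodgeConjecture.HodgeConjecture.Theorems.F0P3cStCharTSHCDLieGlobalDescent     -- ★ GLOBAL ∕ DESCENT at `r = 1∕4` (F0P3a-p07): `exists_centreSplitting`, `continuous_charpoly_discr`, `mem_ker_add_id_iff`; brings ★ (G-FUB), ★ (D3v), ★ (D4c)
import Summits.HodgeConjecture.HodgeConjecture.Theorems.F0P3cStCharTSHCDLieGlobalFinal       -- ★ `isClosed_traceZero`; brings (NG) `mul_self_eq_zero_or_splitSemisimple_of_trace_eq_zero`
import Summits.HodgeConjecture.HodgeConjecture.Theorems.F0P3cStCharTSQuadraticFormNegHalf    -- ★ (D3b) §5 `coe_inv_residueFieldCard_pow_rpow_neg_lt` (the `rpow` contraction ratio)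
import Summits.HodgeConjecture.HodgeConjecture.Theorems.K2E3HCDGroupToLieRpow               -- (ε5) (this seat): dictionary `coe_rpow_neg_quarter`; brings ★ `isClosedEmbedding_subtype`
import Mathlib.Analysis.SpecialFunctions.Pow.Continuity
import HarnessLib

/-!
# K2 · E3 · (SC-an) sub-line «HC-D-ε», file (ε4): THE LIE-ALGEBRA ASSEMBLY OF ROAD «HC-D» AT A REAL EXPONENT `r`
# (case split, vertex by homogeneity, centre-Fubini, descent; `ηᵣ X = (↑|discr χ_X|)^(−r)` locally `∫⁻`-finite on `↥𝔲` from the local inputs)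

Cell `pub/hodgecm-mathlib`, crux H413 = `stmt-HodgeConjecture-24833` (lane `--supports … --as helper`); seat K2E3-p21 (g3) (HC-D-ε sub-lead), (SC-an) line lead
K2E3-p14 (g3), dealer K2E3-plan (g2).  Exponent-parametric twin of ★ `F0P3cStCharTSHCDLieGlobal` + ★ `…LieGlobalDescent` + the glue of ★ `…LieGlobalFinal` (F0P3a-p07),
under the SUB-LINE CONVENTION of (ε5) ★ `K2E3HCDGroupToLieRpow`: one exponent letter `r : ℝ` on the `normAbs K`-token, `ηᵣ X := ((normAbs K (charpoly X).discr : ℝ≥0∞)) ^ (-r)`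
(the ★ token `ηι = (↑√√·)⁻¹` is `r = 1∕4`, §5).  THEOREMS ONLY; sorry-free; no definition ∕ instance ∕ notation.

THE MATHEMATICS ([HarishChandra1970] Part VII §1 Thm. 15, Lie-algebra side, §7).
* §0 `ηᵣ` is continuous on `M₃(K)` for every real `r` (`ENNReal.continuous_rpow_const`), hence Borel on every `↥𝔲₀`.
* §1 CASE SPLIT on `↥𝔲₀` — pure logic over the regularity token `LinearIndependent K ![1, X, X²]`, stated for an ARBITRARY integrand `f : ↥𝔲₀ → [0, ∞]`.
* §2 THE VERTEX at exponent `r`: `ηᵣ (t • Y) = (↑(|t|⁶))^(−r) · ηᵣ Y` (★ (D4c) `discr_smul_fin_three`), so in the (CO) coordinates `Φ₀ : (Fin 8 → F′) ≃ₜ+ ↥𝔲₀` (norm bridge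
  `|ι x|_K = |x|²_{F′}`) the integrand satisfies `g(ϖ • a) = c · g(a)` with **`c = (↑(q⁻¹)¹²)^(−r) = q^{12 r}`**, and ★ (D3v) `forall_exists_nhds_setLIntegral_lt_top_of_homogeneous_pi`
  applies as soon as **`c < q⁸`, i.e. `12 r < 8`** (★ (D3b) `coe_inv_residueFieldCard_pow_rpow_neg_lt`); the sub-line's standing bound `12 r < 5` implies it.
* §3 CENTRE-FUBINI and POINTWISE DESCENT along ★ `exists_centreSplitting` `e (z, Y) = z • 1 + Y`, stated for an ARBITRARY central-translation-invariant integrand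
  `η : M₃(K) → [0, ∞]` (`η (z • 1 + Y) = η Y`, Borel on `↥𝔲₀`) — the ★ proofs verbatim with the weight abstracted (★ (G-FUB) `…_iff_of_prod`, `…_of_prod_symm`); `ηᵣ` is such an
  `η` by ★ (D4c) `discr_add_smul_one_fin_three`.
* §4 HEADS at `ηᵣ`: `…eta_rpow_lt_top_of_local` (local inputs `hreg`, `hnonreg` on `↥𝔲₀`; `12 r < 8`), the pointwise descent `…traceZero_of_lie` (what (ε3)'s trace-zero variant
  docks into), `…_of_local_lie` (inputs on `↥𝔲`), and the (NG)-glued `…_of_reg_sq_ss` (inputs `hreg` = (ε1), `hsq` = (ε2), `hss` = (ε3) in ★ GLOBAL-FINAL's letters) — the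
  binder (ε6) `K2E3HCDModelRpow` consumes.  §5: the `r = 1∕4` instance of `…_of_local` IS ★ `forall_exists_nhds_setLIntegral_etaInv_lt_top_of_local` (dictionary check).
HONEST LABEL: count-neutral; closes no organ; HC_CM is proved only modulo the 7 printed citations (2 remaining named inputs: hLiu418 = `stmt-HodgeConjecture-24832`,
h413 = `stmt-HodgeConjecture-24833`) until rung 0 closes; (SC-an) is NOT ★.

## References
* [HarishChandra1970] Harish-Chandra (notes by G. van Dijk), *Harmonic Analysis on Reductive p-adic Groups*, LNM 162 (1970), Part VII §1 Thm. 15, §7.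
* [Folland1999] G. B. Folland, *Real Analysis* (2nd ed., 1999), §2.5 Thm. 2.37, §11.1 Thm. 11.9.
-/

set_option autoImplicit false
set_option linter.dupNamespace false

noncomputable section

open MeasureTheory MeasureTheory.Measure Filter Topology Set Matrix Finset
open scoped ENNReal NNReal Topology Matrix
open Literature.NumberTheory.GaloisRepresentations Literature.NumberTheory.Automorphic Literature.MeasureTheory.Group Literature.MeasureTheory.Integral
open Literature.LinearAlgebra.Matrix Literature.NumberTheory.GaloisRepresentations.IsNonarchimedeanLocalField
open Summit.HodgeConjecture.HodgeConjecture.Cruxes.H413.F0P3cStCharTSHCDLieGlobal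
open Summit.HodgeConjecture.HodgeConjecture.Cruxes.H413.F0P3cStCharTSHCDLieGlobalFinal
open Summit.HodgeConjecture.HodgeConjecture.Cruxes.H413.F0P3cStCharTSQuadraticFormNegHalf
open Summit.HodgeConjecture.HodgeConjecture.Cruxes.H413.F0P3cStCharTSHCDCayleyChartAt
open Summit.HodgeConjecture.HodgeConjecture.Cruxes.H413.K2E3HCDGroupToLieRpow

namespace Summit.HodgeConjecture.HodgeConjecture.Cruxes.H413.K2E3HCDLieGlobalRpow

variable {K : Type*} [Field K] [ValuativeRel K] [TopologicalSpace K] [IsNonarchimedeanLocalField K]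

/-! ## §0 The integrand `ηᵣ` is continuous, hence measurable, for every real `r` -/

/-- **`ηᵣ X = (↑|discr χ_X|)^(−r)` is continuous on `M₃(K)`** for every real `r` (★ `continuous_charpoly_discr`, ★ `continuous_normAbs`, `ENNReal.continuous_rpow_const`).
[cite: Folland1999, §2.5 Thm. 2.37] -/
theorem continuous_eta_rpow (r : ℝ) :
    Continuous fun X : Matrix (Fin 3) (Fin 3) K => ((normAbs K (Matrix.charpoly X).discr : ℝ≥0∞)) ^ (-r) :=
  ENNReal.continuous_rpow_const.comp (ENNReal.continuous_coe.comp (LocalFieldHaar.continuous_normAbs.comp continuous_charpoly_discr))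

/-- **`ηᵣ` restricted to any subgroup `𝔲₀ ≤ M₃(K)` is measurable** (Borel structure on the subtype), every real `r`. [cite: Folland1999, §2.5 Thm. 2.37] -/
theorem measurable_eta_rpow_subtype (𝔲₀ : AddSubgroup (Matrix (Fin 3) (Fin 3) K)) [MeasurableSpace ↥𝔲₀] [BorelSpace ↥𝔲₀] (r : ℝ) :
    Measurable fun X : ↥𝔲₀ => ((normAbs K (Matrix.charpoly (X : Matrix (Fin 3) (Fin 3) K)).discr : ℝ≥0∞)) ^ (-r) :=
  ((continuous_eta_rpow r).comp continuous_subtype_val).measurable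

/-! ## §1 The case split on `↥𝔲₀` (pure logic over the regularity token, arbitrary integrand) -/

omit [ValuativeRel K] [IsNonarchimedeanLocalField K] in
/-- **GLOBAL ON THE TRACE-ZERO PART FROM THE THREE LOCAL INPUTS**, for an arbitrary integrand `f : ↥𝔲₀ → [0, ∞]`: local `∫⁻`-finiteness at every REGULAR `X₀` (`hreg`), at every
NON-REGULAR `X₀ ≠ 0` (`hnonreg`), and the vertex implication «off `0` ⇒ everywhere» (`hvertex`) give it at every point of `↥𝔲₀`. [cite: HarishChandra1970, Part VII §1 Thm. 15] -/
theorem forall_exists_nhds_setLIntegral_lt_top_traceZero_of_cases (𝔲₀ : AddSubgroup (Matrix (Fin 3) (Fin 3) K)) [MeasurableSpace ↥𝔲₀] (μ₀ : Measure ↥𝔲₀)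
    (f : ↥𝔲₀ → ℝ≥0∞)
    (hreg : ∀ X₀ : ↥𝔲₀, LinearIndependent K ![(1 : Matrix (Fin 3) (Fin 3) K), (X₀ : Matrix (Fin 3) (Fin 3) K), (X₀ : Matrix (Fin 3) (Fin 3) K) ^ 2] →
      ∃ U ∈ 𝓝 X₀, ∫⁻ X in U, f X ∂μ₀ < ∞)
    (hnonreg : ∀ X₀ : ↥𝔲₀, X₀ ≠ 0 → ¬ LinearIndependent K ![(1 : Matrix (Fin 3) (Fin 3) K), (X₀ : Matrix (Fin 3) (Fin 3) K), (X₀ : Matrix (Fin 3) (Fin 3) K) ^ 2] →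
      ∃ U ∈ 𝓝 X₀, ∫⁻ X in U, f X ∂μ₀ < ∞)
    (hvertex : (∀ X₀ : ↥𝔲₀, X₀ ≠ 0 → ∃ U ∈ 𝓝 X₀, ∫⁻ X in U, f X ∂μ₀ < ∞) → ∀ X₀ : ↥𝔲₀, ∃ U ∈ 𝓝 X₀, ∫⁻ X in U, f X ∂μ₀ < ∞) :
    ∀ X₀ : ↥𝔲₀, ∃ U ∈ 𝓝 X₀, ∫⁻ X in U, f X ∂μ₀ < ∞ := by
  refine hvertex fun X₀ hX₀ => ?_
  by_cases h : LinearIndependent K ![(1 : Matrix (Fin 3) (Fin 3) K), (X₀ : Matrix (Fin 3) (Fin 3) K), (X₀ : Matrix (Fin 3) (Fin 3) K) ^ 2]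
  · exact hreg X₀ h
  · exact hnonreg X₀ hX₀ h

/-! ## §2 The vertex at exponent `r` from the coordinate isomorphism (CO) and ★ (D3v) -/

section Vertex

variable {F' : Type*} [Field F'] [ValuativeRel F'] [TopologicalSpace F'] [IsNonarchimedeanLocalField F']

/-- **HOMOGENEITY OF `ηᵣ`**: `ηᵣ (t • Y) = (↑(|t|⁶))^(−r) · ηᵣ Y` in `[0, ∞]`, every real `r` (★ (D4c) `discr_smul_fin_three`: `η (t • Y) = t⁶ η Y`; `ENNReal.mul_rpow_of_ne_top`).
[cite: HarishChandra1970, Part VII §1 Thm. 15] -/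
theorem eta_rpow_smul (t : K) (Y : Matrix (Fin 3) (Fin 3) K) (r : ℝ) :
    ((normAbs K (Matrix.charpoly (t • Y)).discr : ℝ≥0∞)) ^ (-r) =
      ((normAbs K t ^ 6 : ℝ≥0) : ℝ≥0∞) ^ (-r) * ((normAbs K (Matrix.charpoly Y).discr : ℝ≥0∞)) ^ (-r) := by
  have h1 : (Matrix.charpoly (t • Y)).discr = t ^ 6 * (Matrix.charpoly Y).discr := discr_smul_fin_three t Y
  rw [h1, map_mul, map_pow, ENNReal.coe_mul, ENNReal.mul_rpow_of_ne_top ENNReal.coe_ne_top ENNReal.coe_ne_top]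

/-- **THE VERTEX ON `↥𝔲₀` AT EXPONENT `r` (D5(iv)).**  Carriers: any additive subgroup `𝔲₀ ≤ M₃(K)` with an additive Haar measure `μ₀`; a non-archimedean local field `F′`
with `ι : F′ →+* K` and the NORM BRIDGE `|ι x|_K = |x|²_{F′}`; the (CO) isomorphism `Φ₀ : (Fin 8 → F′) ≃ₜ+ ↥𝔲₀` with scaling equivariance.  If `12 r < 8` and `ηᵣ` is locally
`∫⁻`-finite at every `X₀ ≠ 0` of `↥𝔲₀`, it is so at every `X₀`: in coordinates `g := ηᵣ ∘ Φ₀` satisfies `g (ϖ • a) = q^{12r} · g a` (`η` homogeneous of degree `6`,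
`|ι ϖ|_K = q⁻²`), and `q^{12 r} < q⁸`, so ★ (D3v) applies; ★ (G-FUB) `…_iff_of_addEquiv` moves local finiteness along `Φ₀` both ways.
[cite: HarishChandra1970, Part VII §1 Thm. 15] [cite: Folland1999, §11.1 Thm. 11.9] -/
theorem forall_exists_nhds_setLIntegral_eta_rpow_lt_top_traceZero_of_off_zero
    (𝔲₀ : AddSubgroup (Matrix (Fin 3) (Fin 3) K)) [MeasurableSpace ↥𝔲₀] [BorelSpace ↥𝔲₀] (μ₀ : Measure ↥𝔲₀) [μ₀.IsAddHaarMeasure]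
    (ι : F' →+* K) (hιn : ∀ x : F', normAbs K (ι x) = normAbs F' x ^ 2)
    (Φ₀ : (Fin 8 → F') ≃ₜ+ ↥𝔲₀)
    (hΦ₀ : ∀ (l : F') (a : Fin 8 → F'), ((Φ₀ (l • a) : ↥𝔲₀) : Matrix (Fin 3) (Fin 3) K) = ι l • ((Φ₀ a : ↥𝔲₀) : Matrix (Fin 3) (Fin 3) K))
    {r : ℝ} (hr8 : 12 * r < 8)
    (hoff : ∀ X₀ : ↥𝔲₀, X₀ ≠ 0 →
      ∃ U ∈ 𝓝 X₀, ∫⁻ X in U, ((normAbs K (Matrix.charpoly (X : Matrix (Fin 3) (Fin 3) K)).discr : ℝ≥0∞)) ^ (-r) ∂μ₀ < ∞) :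
    ∀ X₀ : ↥𝔲₀, ∃ U ∈ 𝓝 X₀,
      ∫⁻ X in U, ((normAbs K (Matrix.charpoly (X : Matrix (Fin 3) (Fin 3) K)).discr : ℝ≥0∞)) ^ (-r) ∂μ₀ < ∞ := by
  classical
  -- instances on the coordinate space `Fin 8 → F′`
  haveI : T2Space F' := (IsNonarchimedeanLocalField.isLocalField F').toT2Space
  haveI := secondCountableTopology_localField F'
  letI : MeasurableSpace F' := borel F'
  haveI : BorelSpace F' := ⟨rfl⟩
  -- instances on `↥𝔲₀`, transported from the coordinates
  haveI : LocallyCompactSpace ↥𝔲₀ := Φ₀.toHomeomorph.symm.isClosedEmbedding.locallyCompactSpace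
  haveI : SecondCountableTopology ↥𝔲₀ := Φ₀.toHomeomorph.symm.secondCountableTopology
  set ν : Measure (Fin 8 → F') := Measure.addHaar with hν
  -- the integrand
  set f : ↥𝔲₀ → ℝ≥0∞ := fun X => ((normAbs K (Matrix.charpoly (X : Matrix (Fin 3) (Fin 3) K)).discr : ℝ≥0∞)) ^ (-r) with hfdef
  -- a uniformizer of `F′` and the contraction ratio `c = q^{12 r}`
  obtain ⟨ϖ, _, hϖ⟩ := exists_normAbs_eq_inv (F := F')
  set c : ℝ≥0∞ := ((((residueFieldCard F' : ℝ≥0))⁻¹ ^ 12 : ℝ≥0) : ℝ≥0∞) ^ (-r) with hcdef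
  -- homogeneity in coordinates: `f (Φ₀ (ϖ • a)) = c · f (Φ₀ a)`
  have hhom : ∀ a : Fin 8 → F', a ≠ 0 → f (Φ₀ (fun i => ϖ * a i)) ≤ c * f (Φ₀ a) := by
    intro a _
    have hsm : (fun i => ϖ * a i) = ϖ • a := by funext i; simp [Pi.smul_apply, smul_eq_mul]
    rw [hsm]
    simp only [hfdef]
    rw [hΦ₀ ϖ a, eta_rpow_smul (ι ϖ) _ r, hιn, hϖ,
      show (((residueFieldCard F' : ℝ≥0))⁻¹ ^ 2) ^ 6 = ((residueFieldCard F' : ℝ≥0))⁻¹ ^ 12 by ring, hcdef]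
  have hc : c < (residueFieldCard F' : ℝ≥0∞) ^ (∑ _i : Fin 8, (1 : ℕ)) := by
    rw [Finset.sum_const, Finset.card_univ, Fintype.card_fin, smul_eq_mul, mul_one, hcdef]
    exact coe_inv_residueFieldCard_pow_rpow_neg_lt (F := F') (by push_cast; linarith)
  -- off-zero finiteness in coordinates
  have hoff' : ∀ a : Fin 8 → F', a ≠ 0 → ∃ U ∈ 𝓝 a, ∫⁻ x in U, f (Φ₀ x) ∂ν < ∞ := by
    intro a ha
    have hΦa : Φ₀ a ≠ 0 := fun h => ha (Φ₀.injective (by rw [h, map_zero]))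
    exact (exists_nhds_setLIntegral_lt_top_iff_of_addEquiv Φ₀ ν μ₀ f a).1 (hoff (Φ₀ a) hΦa)
  -- ★ (D3v) on the coordinate space
  have hall := forall_exists_nhds_setLIntegral_lt_top_of_homogeneous_pi ν (fun _ : Fin 8 => ϖ) (fun _ => 1) (fun _ => le_rfl)
    (fun _ => by rw [pow_one, hϖ]) (fun x => f (Φ₀ x)) c hhom hc hoff'
  -- back to `↥𝔲₀`
  exact (forall_exists_nhds_setLIntegral_lt_top_iff_of_addEquiv Φ₀ ν μ₀ f).2 hall

end Vertex

/-! ## §3 Centre-Fubini and pointwise descent along the centre splitting, for any central-translation-invariant integrand -/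

section Centre

variable {σ : K →+* K}

/-- **CENTRE TRANSFER (both directions) FOR A CENTRAL-TRANSLATION-INVARIANT INTEGRAND.**  `σ` continuous, `J` with invertible determinant, `(3 : K) ≠ 0`; `𝔲`, `𝔲₀` the carriers
with ANY additive Haar measures `μ`, `μ₀`; `η : M₃(K) → [0, ∞]` Borel on `↥𝔲₀` with `η (z • 1 + Y) = η Y`.  Along ★ `exists_centreSplitting` `e : ↥K⁻ × ↥𝔲₀ ≃ₜ+ ↥𝔲`,
`e (z, Y) = z • 1 + Y`: (a) local `∫⁻`-finiteness of `η` at every point of `↥𝔲₀` gives it at every point of `↥𝔲` (★ (G-FUB) `…_iff_of_prod`); (b) local finiteness near a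
trace-zero `Y₀` viewed in `↥𝔲` descends to `Y₀ ∈ ↥𝔲₀` (★ (G-FUB) `…_of_prod_symm` at `z = 0`).  The ★ GLOBAL §3 ∕ DESCENT §1 proofs with the weight abstracted.
[cite: HarishChandra1970, Part VII §1 Thm. 15] [cite: Folland1999, §11.1 Thm. 11.9] -/
theorem centre_transfer_of_central (hσc : Continuous σ)
    {J : Matrix (Fin 3) (Fin 3) K} (hJd : IsUnit J.det) (h3 : (3 : K) ≠ 0)
    (𝔲 : AddSubgroup (Matrix (Fin 3) (Fin 3) K)) (h𝔲 : ∀ X, X ∈ 𝔲 ↔ (X.map σ)ᵀ * J + J * X = 0)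
    (𝔲₀ : AddSubgroup (Matrix (Fin 3) (Fin 3) K)) (h𝔲₀ : ∀ X, X ∈ 𝔲₀ ↔ (X.map σ)ᵀ * J + J * X = 0 ∧ Matrix.trace X = 0)
    [MeasurableSpace ↥𝔲₀] [BorelSpace ↥𝔲₀] (μ₀ : Measure ↥𝔲₀) [μ₀.IsAddHaarMeasure]
    [MeasurableSpace ↥𝔲] [BorelSpace ↥𝔲] (μ : Measure ↥𝔲) [μ.IsAddHaarMeasure]
    (η : Matrix (Fin 3) (Fin 3) K → ℝ≥0∞) (hηm : Measurable fun Y : ↥𝔲₀ => η (Y : Matrix (Fin 3) (Fin 3) K))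
    (hηz : ∀ (z : K) (Y : Matrix (Fin 3) (Fin 3) K), η (z • (1 : Matrix (Fin 3) (Fin 3) K) + Y) = η Y) :
    ((∀ Y₀ : ↥𝔲₀, ∃ U ∈ 𝓝 Y₀, ∫⁻ X in U, η (X : Matrix (Fin 3) (Fin 3) K) ∂μ₀ < ∞) →
        ∀ X₀ : ↥𝔲, ∃ U ∈ 𝓝 X₀, ∫⁻ X in U, η (X : Matrix (Fin 3) (Fin 3) K) ∂μ < ∞) ∧
      ∀ Y₀ : ↥𝔲₀, (∃ U ∈ 𝓝 (⟨(Y₀ : Matrix (Fin 3) (Fin 3) K), (h𝔲 _).2 ((h𝔲₀ _).1 Y₀.2).1⟩ : ↥𝔲),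
          ∫⁻ X in U, η (X : Matrix (Fin 3) (Fin 3) K) ∂μ < ∞) →
        ∃ U ∈ 𝓝 Y₀, ∫⁻ X in U, η (X : Matrix (Fin 3) (Fin 3) K) ∂μ₀ < ∞ := by
  classical
  haveI : T2Space K := (IsNonarchimedeanLocalField.isLocalField K).toT2Space
  haveI := secondCountableTopology_localField K
  -- the skew scalars: closed, hence locally compact; Borel structure and a Haar measure
  set Z : AddSubgroup K := ((σ : K →+* K).toAddMonoidHom + AddMonoidHom.id K).ker with hZ
  have memZ : ∀ z : K, z ∈ Z ↔ σ z = -z := fun z => mem_ker_add_id_iff σ z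
  have hZc : IsClosed (Z : Set K) := by
    have : (Z : Set K) = {z | σ z + z = 0} := by
      ext z; rw [SetLike.mem_coe, memZ, Set.mem_setOf_eq, add_eq_zero_iff_eq_neg]
    rw [this]
    exact isClosed_eq (hσc.add continuous_id) continuous_const
  letI : MeasurableSpace ↥Z := borel ↥Z
  haveI : BorelSpace ↥Z := ⟨rfl⟩
  haveI : LocallyCompactSpace ↥Z := hZc.locallyCompactSpace
  haveI : SecondCountableTopology ↥Z := TopologicalSpace.Subtype.secondCountableTopology _
  -- `𝔲`, `𝔲₀` are closed, hence locally compact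
  haveI : LocallyCompactSpace (Matrix (Fin 3) (Fin 3) K) := inferInstanceAs (LocallyCompactSpace (Fin 3 → Fin 3 → K))
  haveI : SecondCountableTopology (Matrix (Fin 3) (Fin 3) K) := inferInstanceAs (SecondCountableTopology (Fin 3 → Fin 3 → K))
  haveI : LocallyCompactSpace ↥𝔲 := (isClosedEmbedding_subtype σ J 𝔲 hσc h𝔲).locallyCompactSpace
  haveI : LocallyCompactSpace ↥𝔲₀ := (isClosed_traceZero hσc J 𝔲₀ h𝔲₀).locallyCompactSpace
  haveI : SecondCountableTopology ↥𝔲 := TopologicalSpace.Subtype.secondCountableTopology _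
  haveI : SecondCountableTopology ↥𝔲₀ := TopologicalSpace.Subtype.secondCountableTopology _
  -- the splitting and the invariance of the integrand along the centre
  obtain ⟨e, he⟩ := exists_centreSplitting hJd h3 𝔲 h𝔲 𝔲₀ h𝔲₀
  have hfg : ∀ (z : ↥Z) (Y : ↥𝔲₀), (fun X : ↥𝔲 => η (X : Matrix (Fin 3) (Fin 3) K)) (e (z, Y)) = η (Y : Matrix (Fin 3) (Fin 3) K) := by
    intro z Y
    dsimp only
    rw [he, hηz]
  refine ⟨fun h0 => (forall_exists_nhds_setLIntegral_lt_top_iff_of_prod e μ₀ μ (Measure.addHaar : Measure ↥Z)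
    (f := fun X : ↥𝔲 => η (X : Matrix (Fin 3) (Fin 3) K)) (g := fun Y : ↥𝔲₀ => η (Y : Matrix (Fin 3) (Fin 3) K)) hηm hfg).2 h0, fun Y₀ hY => ?_⟩
  -- `e (0, Y₀)` is `Y₀` viewed in `𝔲`
  have he0 : e (0, Y₀) = ⟨(Y₀ : Matrix (Fin 3) (Fin 3) K), (h𝔲 _).2 ((h𝔲₀ _).1 Y₀.2).1⟩ := by
    apply Subtype.ext
    rw [he]
    change ((0 : K)) • (1 : Matrix (Fin 3) (Fin 3) K) + (Y₀ : Matrix (Fin 3) (Fin 3) K) = (Y₀ : Matrix (Fin 3) (Fin 3) K)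
    rw [zero_smul, zero_add]
  refine exists_nhds_setLIntegral_lt_top_of_prod_symm e μ₀ μ (Measure.addHaar : Measure ↥Z)
    (f := fun X : ↥𝔲 => η (X : Matrix (Fin 3) (Fin 3) K)) (g := fun Y : ↥𝔲₀ => η (Y : Matrix (Fin 3) (Fin 3) K)) hηm hfg (z := 0) ?_
  rw [he0]
  exact hY

/-- `ηᵣ` is invariant under central translations: `ηᵣ (z • 1 + Y) = ηᵣ Y` (★ (D4c) `discr_add_smul_one_fin_three`). [cite: HarishChandra1970, Part VII §1 Thm. 15] -/
theorem eta_rpow_smul_one_add (z : K) (Y : Matrix (Fin 3) (Fin 3) K) (r : ℝ) :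
    ((normAbs K (Matrix.charpoly (z • (1 : Matrix (Fin 3) (Fin 3) K) + Y)).discr : ℝ≥0∞)) ^ (-r) =
      ((normAbs K (Matrix.charpoly Y).discr : ℝ≥0∞)) ^ (-r) := by
  have hd : (Matrix.charpoly (z • (1 : Matrix (Fin 3) (Fin 3) K) + Y)).discr = (Matrix.charpoly Y).discr := by
    rw [add_comm]; exact discr_add_smul_one_fin_three _ _
  rw [hd]

end Centre

/-! ## §4 HEADS at `ηᵣ` -/

section Heads

variable {σ : K →+* K}

/-- **(ε4) HEAD — GLOBAL ON THE UNITARY LIE ALGEBRA `↥𝔲` AT EXPONENT `r`.**  From the local inputs on the trace-zero part — `hreg` at REGULAR points (D5(i) = (ε1)), `hnonreg` at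
NON-REGULAR `X₀ ≠ 0` (D5(ii)+(iii) = (ε2)+(ε3)) — and the (CO) coordinate letters (`ι`, norm bridge, `Φ₀` with scaling equivariance): for `12 r < 8`, `ηᵣ X = (↑|discr χ_X|)^(−r)` is
locally `∫⁻`-finite at every point of `↥𝔲`, for ANY additive Haar measures `μ₀`, `μ` (§1 + §2 + §3).  Binders = ★ `forall_exists_nhds_setLIntegral_etaInv_lt_top_of_local` with
`{r} (hr8)` inserted before `hreg` and the token `ηι ↦ ηᵣ`. [cite: HarishChandra1970, Part VII §1 Thm. 15] [cite: Folland1999, §11.1 Thm. 11.9] -/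
theorem forall_exists_nhds_setLIntegral_eta_rpow_lt_top_of_local
    (hσc : Continuous σ) {J : Matrix (Fin 3) (Fin 3) K} (hJd : IsUnit J.det) (h3 : (3 : K) ≠ 0)
    (𝔲 : AddSubgroup (Matrix (Fin 3) (Fin 3) K)) (h𝔲 : ∀ X, X ∈ 𝔲 ↔ (X.map σ)ᵀ * J + J * X = 0)
    (𝔲₀ : AddSubgroup (Matrix (Fin 3) (Fin 3) K)) (h𝔲₀ : ∀ X, X ∈ 𝔲₀ ↔ (X.map σ)ᵀ * J + J * X = 0 ∧ Matrix.trace X = 0)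
    [MeasurableSpace ↥𝔲₀] [BorelSpace ↥𝔲₀] (μ₀ : Measure ↥𝔲₀) [μ₀.IsAddHaarMeasure]
    [MeasurableSpace ↥𝔲] [BorelSpace ↥𝔲] (μ : Measure ↥𝔲) [μ.IsAddHaarMeasure]
    {F' : Type*} [Field F'] [ValuativeRel F'] [TopologicalSpace F'] [IsNonarchimedeanLocalField F']
    (ι : F' →+* K) (hιn : ∀ x : F', normAbs K (ι x) = normAbs F' x ^ 2)
    (Φ₀ : (Fin 8 → F') ≃ₜ+ ↥𝔲₀)
    (hΦ₀ : ∀ (l : F') (a : Fin 8 → F'), ((Φ₀ (l • a) : ↥𝔲₀) : Matrix (Fin 3) (Fin 3) K) = ι l • ((Φ₀ a : ↥𝔲₀) : Matrix (Fin 3) (Fin 3) K))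
    {r : ℝ} (hr8 : 12 * r < 8)
    (hreg : ∀ X₀ : ↥𝔲₀, LinearIndependent K ![(1 : Matrix (Fin 3) (Fin 3) K), (X₀ : Matrix (Fin 3) (Fin 3) K), (X₀ : Matrix (Fin 3) (Fin 3) K) ^ 2] →
      ∃ U ∈ 𝓝 X₀, ∫⁻ X in U, ((normAbs K (Matrix.charpoly (X : Matrix (Fin 3) (Fin 3) K)).discr : ℝ≥0∞)) ^ (-r) ∂μ₀ < ∞)
    (hnonreg : ∀ X₀ : ↥𝔲₀, X₀ ≠ 0 → ¬ LinearIndependent K ![(1 : Matrix (Fin 3) (Fin 3) K), (X₀ : Matrix (Fin 3) (Fin 3) K), (X₀ : Matrix (Fin 3) (Fin 3) K) ^ 2] →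
      ∃ U ∈ 𝓝 X₀, ∫⁻ X in U, ((normAbs K (Matrix.charpoly (X : Matrix (Fin 3) (Fin 3) K)).discr : ℝ≥0∞)) ^ (-r) ∂μ₀ < ∞) :
    ∀ X₀ : ↥𝔲, ∃ U ∈ 𝓝 X₀,
      ∫⁻ X in U, ((normAbs K (Matrix.charpoly (X : Matrix (Fin 3) (Fin 3) K)).discr : ℝ≥0∞)) ^ (-r) ∂μ < ∞ :=
  (centre_transfer_of_central hσc hJd h3 𝔲 h𝔲 𝔲₀ h𝔲₀ μ₀ μ (fun X => ((normAbs K (Matrix.charpoly X).discr : ℝ≥0∞)) ^ (-r))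
      (measurable_eta_rpow_subtype 𝔲₀ r) (fun z Y => eta_rpow_smul_one_add z Y r)).1
    (forall_exists_nhds_setLIntegral_lt_top_traceZero_of_cases 𝔲₀ μ₀ _ hreg hnonreg
      (forall_exists_nhds_setLIntegral_eta_rpow_lt_top_traceZero_of_off_zero 𝔲₀ μ₀ ι hιn Φ₀ hΦ₀ hr8))

/-- **POINTWISE DESCENT `↥𝔲 ⇒ ↥𝔲₀` AT EXPONENT `r`**: if `ηᵣ` is locally `∫⁻`-finite (ANY Haar `μ` on `↥𝔲`) near a trace-zero `Y₀` viewed in `↥𝔲`, then near `Y₀` in `↥𝔲₀` (ANY Haar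
`μ₀`) — what the (ε2)∕(ε3) hands, whose slices live in `𝔲`, dock into (binders = ★ `…LieGlobalDescent.exists_nhds_setLIntegral_etaInv_lt_top_traceZero_of_lie` + `(r)` before `Y₀`).
[cite: HarishChandra1970, Part VII §1 Thm. 15] [cite: Folland1999, §11.1 Thm. 11.9] -/
theorem exists_nhds_setLIntegral_eta_rpow_lt_top_traceZero_of_lie (hσc : Continuous σ)
    {J : Matrix (Fin 3) (Fin 3) K} (hJd : IsUnit J.det) (h3 : (3 : K) ≠ 0)
    (𝔲 : AddSubgroup (Matrix (Fin 3) (Fin 3) K)) (h𝔲 : ∀ X, X ∈ 𝔲 ↔ (X.map σ)ᵀ * J + J * X = 0)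
    (𝔲₀ : AddSubgroup (Matrix (Fin 3) (Fin 3) K)) (h𝔲₀ : ∀ X, X ∈ 𝔲₀ ↔ (X.map σ)ᵀ * J + J * X = 0 ∧ Matrix.trace X = 0)
    [MeasurableSpace ↥𝔲₀] [BorelSpace ↥𝔲₀] (μ₀ : Measure ↥𝔲₀) [μ₀.IsAddHaarMeasure]
    [MeasurableSpace ↥𝔲] [BorelSpace ↥𝔲] (μ : Measure ↥𝔲) [μ.IsAddHaarMeasure]
    (r : ℝ) (Y₀ : ↥𝔲₀)
    (hY : ∃ U ∈ 𝓝 (⟨(Y₀ : Matrix (Fin 3) (Fin 3) K), (h𝔲 _).2 ((h𝔲₀ _).1 Y₀.2).1⟩ : ↥𝔲),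
      ∫⁻ X in U, ((normAbs K (Matrix.charpoly (X : Matrix (Fin 3) (Fin 3) K)).discr : ℝ≥0∞)) ^ (-r) ∂μ < ∞) :
    ∃ U ∈ 𝓝 Y₀,
      ∫⁻ X in U, ((normAbs K (Matrix.charpoly (X : Matrix (Fin 3) (Fin 3) K)).discr : ℝ≥0∞)) ^ (-r) ∂μ₀ < ∞ :=
  (centre_transfer_of_central hσc hJd h3 𝔲 h𝔲 𝔲₀ h𝔲₀ μ₀ μ (fun X => ((normAbs K (Matrix.charpoly X).discr : ℝ≥0∞)) ^ (-r))
      (measurable_eta_rpow_subtype 𝔲₀ r) (fun z Y => eta_rpow_smul_one_add z Y r)).2 Y₀ hY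

/-- **GLOBAL ON `↥𝔲` AT EXPONENT `r`, LOCAL INPUTS STATED ON `↥𝔲`**: `hreg` at REGULAR points of `↥𝔲`, `hnonreg` at NON-CENTRAL non-regular points of `↥𝔲` (`∀ a, X₀ ≠ a • 1`),
both against ANY Haar `μ` on `↥𝔲`; they descend to `↥𝔲₀` by `exists_nhds_setLIntegral_eta_rpow_lt_top_traceZero_of_lie`, and `…_of_local` concludes (`12 r < 8`).
[cite: HarishChandra1970, Part VII §1 Thm. 15] [cite: Folland1999, §11.1 Thm. 11.9] -/
theorem forall_exists_nhds_setLIntegral_eta_rpow_lt_top_of_local_lie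
    (hσc : Continuous σ) {J : Matrix (Fin 3) (Fin 3) K} (hJd : IsUnit J.det) (h3 : (3 : K) ≠ 0)
    (𝔲 : AddSubgroup (Matrix (Fin 3) (Fin 3) K)) (h𝔲 : ∀ X, X ∈ 𝔲 ↔ (X.map σ)ᵀ * J + J * X = 0)
    (𝔲₀ : AddSubgroup (Matrix (Fin 3) (Fin 3) K)) (h𝔲₀ : ∀ X, X ∈ 𝔲₀ ↔ (X.map σ)ᵀ * J + J * X = 0 ∧ Matrix.trace X = 0)
    [MeasurableSpace ↥𝔲₀] [BorelSpace ↥𝔲₀] (μ₀ : Measure ↥𝔲₀) [μ₀.IsAddHaarMeasure]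
    [MeasurableSpace ↥𝔲] [BorelSpace ↥𝔲] (μ : Measure ↥𝔲) [μ.IsAddHaarMeasure]
    {F' : Type*} [Field F'] [ValuativeRel F'] [TopologicalSpace F'] [IsNonarchimedeanLocalField F']
    (ι : F' →+* K) (hιn : ∀ x : F', normAbs K (ι x) = normAbs F' x ^ 2)
    (Φ₀ : (Fin 8 → F') ≃ₜ+ ↥𝔲₀)
    (hΦ₀ : ∀ (l : F') (a : Fin 8 → F'), ((Φ₀ (l • a) : ↥𝔲₀) : Matrix (Fin 3) (Fin 3) K) = ι l • ((Φ₀ a : ↥𝔲₀) : Matrix (Fin 3) (Fin 3) K))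
    {r : ℝ} (hr8 : 12 * r < 8)
    (hreg : ∀ X₀ : ↥𝔲, LinearIndependent K ![(1 : Matrix (Fin 3) (Fin 3) K), (X₀ : Matrix (Fin 3) (Fin 3) K), (X₀ : Matrix (Fin 3) (Fin 3) K) ^ 2] →
      ∃ U ∈ 𝓝 X₀, ∫⁻ X in U, ((normAbs K (Matrix.charpoly (X : Matrix (Fin 3) (Fin 3) K)).discr : ℝ≥0∞)) ^ (-r) ∂μ < ∞)
    (hnonreg : ∀ X₀ : ↥𝔲, (∀ a : K, (X₀ : Matrix (Fin 3) (Fin 3) K) ≠ a • 1) →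
      ¬ LinearIndependent K ![(1 : Matrix (Fin 3) (Fin 3) K), (X₀ : Matrix (Fin 3) (Fin 3) K), (X₀ : Matrix (Fin 3) (Fin 3) K) ^ 2] →
      ∃ U ∈ 𝓝 X₀, ∫⁻ X in U, ((normAbs K (Matrix.charpoly (X : Matrix (Fin 3) (Fin 3) K)).discr : ℝ≥0∞)) ^ (-r) ∂μ < ∞) :
    ∀ X₀ : ↥𝔲, ∃ U ∈ 𝓝 X₀,
      ∫⁻ X in U, ((normAbs K (Matrix.charpoly (X : Matrix (Fin 3) (Fin 3) K)).discr : ℝ≥0∞)) ^ (-r) ∂μ < ∞ := by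
  refine forall_exists_nhds_setLIntegral_eta_rpow_lt_top_of_local hσc hJd h3 𝔲 h𝔲 𝔲₀ h𝔲₀ μ₀ μ ι hιn Φ₀ hΦ₀ hr8 ?_ ?_
  · intro Y₀ hli
    exact exists_nhds_setLIntegral_eta_rpow_lt_top_traceZero_of_lie hσc hJd h3 𝔲 h𝔲 𝔲₀ h𝔲₀ μ₀ μ r Y₀ (hreg _ hli)
  · intro Y₀ hY0 hli
    refine exists_nhds_setLIntegral_eta_rpow_lt_top_traceZero_of_lie hσc hJd h3 𝔲 h𝔲 𝔲₀ h𝔲₀ μ₀ μ r Y₀ (hnonreg _ ?_ hli)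
    intro a ha
    apply hY0
    apply Subtype.ext
    have htr : Matrix.trace (Y₀ : Matrix (Fin 3) (Fin 3) K) = 0 := ((h𝔲₀ _).1 Y₀.2).2
    have ha0 : a = 0 := by
      have h := htr
      rw [show (Y₀ : Matrix (Fin 3) (Fin 3) K) = a • 1 from ha, Matrix.trace_smul, Matrix.trace_one, Fintype.card_fin, smul_eq_mul] at h
      push_cast at h
      rcases mul_eq_zero.1 h with h | h
      · exact h
      · exact absurd h h3
    change (Y₀ : Matrix (Fin 3) (Fin 3) K) = 0
    rw [show (Y₀ : Matrix (Fin 3) (Fin 3) K) = a • 1 from ha, ha0, zero_smul]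

/-- **GLOBAL AT EXPONENT `r` FROM THE THREE STRATA (the (ε6) docking point).**  In ★ GLOBAL-FINAL's letters on the trace-zero part `↥𝔲₀`: `hreg` (REGULAR points — (ε1)
`K2E3HCDRegularPointsRpow`), `hsq` (non-zero SQUARE-ZERO points — (ε2)), `hss` (SPLIT SEMISIMPLE NON-SCALAR points — (ε3)); the non-regular non-zero trace-zero points are
exactly the last two kinds by (NG) `mul_self_eq_zero_or_splitSemisimple_of_trace_eq_zero` (`3 ≠ 0`).  Conclusion: `ηᵣ` locally `∫⁻`-finite at every point of `↥𝔲` (`12 r < 8`).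
[cite: HarishChandra1970, Part VII §1 Thm. 15] [cite: Folland1999, §11.1 Thm. 11.9] -/
theorem forall_exists_nhds_setLIntegral_eta_rpow_lt_top_of_reg_sq_ss
    (hσc : Continuous σ) {J : Matrix (Fin 3) (Fin 3) K} (hJd : IsUnit J.det) (h3 : (3 : K) ≠ 0)
    (𝔲 : AddSubgroup (Matrix (Fin 3) (Fin 3) K)) (h𝔲 : ∀ X, X ∈ 𝔲 ↔ (X.map σ)ᵀ * J + J * X = 0)
    (𝔲₀ : AddSubgroup (Matrix (Fin 3) (Fin 3) K)) (h𝔲₀ : ∀ X, X ∈ 𝔲₀ ↔ (X.map σ)ᵀ * J + J * X = 0 ∧ Matrix.trace X = 0)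
    [MeasurableSpace ↥𝔲₀] [BorelSpace ↥𝔲₀] (μ₀ : Measure ↥𝔲₀) [μ₀.IsAddHaarMeasure]
    [MeasurableSpace ↥𝔲] [BorelSpace ↥𝔲] (μ : Measure ↥𝔲) [μ.IsAddHaarMeasure]
    {F' : Type*} [Field F'] [ValuativeRel F'] [TopologicalSpace F'] [IsNonarchimedeanLocalField F']
    (ι : F' →+* K) (hιn : ∀ x : F', normAbs K (ι x) = normAbs F' x ^ 2)
    (Φ₀ : (Fin 8 → F') ≃ₜ+ ↥𝔲₀)
    (hΦ₀ : ∀ (l : F') (a : Fin 8 → F'), ((Φ₀ (l • a) : ↥𝔲₀) : Matrix (Fin 3) (Fin 3) K) = ι l • ((Φ₀ a : ↥𝔲₀) : Matrix (Fin 3) (Fin 3) K))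
    {r : ℝ} (hr8 : 12 * r < 8)
    (hreg : ∀ X₀ : ↥𝔲₀, LinearIndependent K ![(1 : Matrix (Fin 3) (Fin 3) K), (X₀ : Matrix (Fin 3) (Fin 3) K), (X₀ : Matrix (Fin 3) (Fin 3) K) ^ 2] →
      ∃ U ∈ 𝓝 X₀, ∫⁻ X in U, ((normAbs K (Matrix.charpoly (X : Matrix (Fin 3) (Fin 3) K)).discr : ℝ≥0∞)) ^ (-r) ∂μ₀ < ∞)
    (hsq : ∀ X₀ : ↥𝔲₀, X₀ ≠ 0 → (X₀ : Matrix (Fin 3) (Fin 3) K) * (X₀ : Matrix (Fin 3) (Fin 3) K) = 0 →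
      ∃ U ∈ 𝓝 X₀, ∫⁻ X in U, ((normAbs K (Matrix.charpoly (X : Matrix (Fin 3) (Fin 3) K)).discr : ℝ≥0∞)) ^ (-r) ∂μ₀ < ∞)
    (hss : ∀ X₀ : ↥𝔲₀, (∃ a b : K, a ≠ b ∧ ((X₀ : Matrix (Fin 3) (Fin 3) K) - a • (1 : Matrix (Fin 3) (Fin 3) K)) * ((X₀ : Matrix (Fin 3) (Fin 3) K) - b • 1) = 0 ∧
        ∀ c : K, (X₀ : Matrix (Fin 3) (Fin 3) K) ≠ c • 1) →
      ∃ U ∈ 𝓝 X₀, ∫⁻ X in U, ((normAbs K (Matrix.charpoly (X : Matrix (Fin 3) (Fin 3) K)).discr : ℝ≥0∞)) ^ (-r) ∂μ₀ < ∞) :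
    ∀ X₀ : ↥𝔲, ∃ U ∈ 𝓝 X₀,
      ∫⁻ X in U, ((normAbs K (Matrix.charpoly (X : Matrix (Fin 3) (Fin 3) K)).discr : ℝ≥0∞)) ^ (-r) ∂μ < ∞ := by
  refine forall_exists_nhds_setLIntegral_eta_rpow_lt_top_of_local hσc hJd h3 𝔲 h𝔲 𝔲₀ h𝔲₀ μ₀ μ ι hιn Φ₀ hΦ₀ hr8 hreg ?_
  intro X₀ hX₀ hnr
  have htr : Matrix.trace (X₀ : Matrix (Fin 3) (Fin 3) K) = 0 := ((h𝔲₀ _).1 X₀.2).2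
  have h0 : (X₀ : Matrix (Fin 3) (Fin 3) K) ≠ 0 := fun h => hX₀ (Subtype.ext h)
  rcases mul_self_eq_zero_or_splitSemisimple_of_trace_eq_zero h3 htr h0 hnr with hN | hS
  · exact hsq X₀ hX₀ hN
  · exact hss X₀ hS

end Heads

/-! ## §5 Dictionary check: the `r = 1∕4` instance is ★ GLOBAL `…_of_local` -/

/-- **(ε4) at the ★ exponent**: `forall_exists_nhds_setLIntegral_eta_rpow_lt_top_of_local` at `r = 1∕4` IS ★ `F0P3cStCharTSHCDLieGlobal.forall_exists_nhds_setLIntegral_etaInv_lt_top_of_local`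
(every token rewritten by (ε5) `coe_rpow_neg_quarter`; `12 · ¼ = 3 < 8`). [cite: HarishChandra1970, Part VII §1 Thm. 15] -/
theorem forall_exists_nhds_setLIntegral_eta_rpow_quarter_lt_top_of_local
    {σ : K →+* K} (hσc : Continuous σ)
    {J : Matrix (Fin 3) (Fin 3) K} (hJd : IsUnit J.det) (h3 : (3 : K) ≠ 0)
    (𝔲 : AddSubgroup (Matrix (Fin 3) (Fin 3) K)) (h𝔲 : ∀ X, X ∈ 𝔲 ↔ (X.map σ)ᵀ * J + J * X = 0)
    (𝔲₀ : AddSubgroup (Matrix (Fin 3) (Fin 3) K)) (h𝔲₀ : ∀ X, X ∈ 𝔲₀ ↔ (X.map σ)ᵀ * J + J * X = 0 ∧ Matrix.trace X = 0)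
    [MeasurableSpace ↥𝔲₀] [BorelSpace ↥𝔲₀] (μ₀ : Measure ↥𝔲₀) [μ₀.IsAddHaarMeasure]
    [MeasurableSpace ↥𝔲] [BorelSpace ↥𝔲] (μ : Measure ↥𝔲) [μ.IsAddHaarMeasure]
    {F' : Type*} [Field F'] [ValuativeRel F'] [TopologicalSpace F'] [IsNonarchimedeanLocalField F']
    (ι : F' →+* K) (hιn : ∀ x : F', normAbs K (ι x) = normAbs F' x ^ 2)
    (Φ₀ : (Fin 8 → F') ≃ₜ+ ↥𝔲₀)
    (hΦ₀ : ∀ (l : F') (a : Fin 8 → F'), ((Φ₀ (l • a) : ↥𝔲₀) : Matrix (Fin 3) (Fin 3) K) = ι l • ((Φ₀ a : ↥𝔲₀) : Matrix (Fin 3) (Fin 3) K))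
    (hreg : ∀ X₀ : ↥𝔲₀, LinearIndependent K ![(1 : Matrix (Fin 3) (Fin 3) K), (X₀ : Matrix (Fin 3) (Fin 3) K), (X₀ : Matrix (Fin 3) (Fin 3) K) ^ 2] →
      ∃ U ∈ 𝓝 X₀, ∫⁻ X in U, ((NNReal.sqrt (NNReal.sqrt (normAbs K (Matrix.charpoly (X : Matrix (Fin 3) (Fin 3) K)).discr)) : ℝ≥0∞))⁻¹ ∂μ₀ < ∞)
    (hnonreg : ∀ X₀ : ↥𝔲₀, X₀ ≠ 0 → ¬ LinearIndependent K ![(1 : Matrix (Fin 3) (Fin 3) K), (X₀ : Matrix (Fin 3) (Fin 3) K), (X₀ : Matrix (Fin 3) (Fin 3) K) ^ 2] →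
      ∃ U ∈ 𝓝 X₀, ∫⁻ X in U, ((NNReal.sqrt (NNReal.sqrt (normAbs K (Matrix.charpoly (X : Matrix (Fin 3) (Fin 3) K)).discr)) : ℝ≥0∞))⁻¹ ∂μ₀ < ∞) :
    ∀ X₀ : ↥𝔲, ∃ U ∈ 𝓝 X₀,
      ∫⁻ X in U, ((NNReal.sqrt (NNReal.sqrt (normAbs K (Matrix.charpoly (X : Matrix (Fin 3) (Fin 3) K)).discr)) : ℝ≥0∞))⁻¹ ∂μ < ∞ := by
  have h := forall_exists_nhds_setLIntegral_eta_rpow_lt_top_of_local hσc hJd h3 𝔲 h𝔲 𝔲₀ h𝔲₀ μ₀ μ ι hιn Φ₀ hΦ₀ (r := 1 / 4) (by norm_num) ?_ ?_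
  · intro X₀
    obtain ⟨U, hU, hfin⟩ := h X₀
    refine ⟨U, hU, ?_⟩
    simpa only [coe_rpow_neg_quarter] using hfin
  · intro X₀ hli
    obtain ⟨U, hU, hfin⟩ := hreg X₀ hli
    refine ⟨U, hU, ?_⟩
    simpa only [coe_rpow_neg_quarter] using hfin
  · intro X₀ hX₀ hnr
    obtain ⟨U, hU, hfin⟩ := hnonreg X₀ hX₀ hnr
    refine ⟨U, hU, ?_⟩
    simpa only [coe_rpow_neg_quarter] using hfin

end Summit.HodgeConjecture.HodgeConjecture.Cruxes.H413.K2E3HCDLieGlobalRpow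

end
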